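/-
Copyright: lead seat `ym-line-sll-p1` (prover-ym-line-sll-p1-g0-0), route `SoftLoopLongLag`, cruxes `ColdBoxSoftLoopLagFloor`
(stmt-QuantumFields-23990; stub S2b / planned E1b) and `SoftLoopLagFloorToTorus` (stmt-QuantumFields-22504; stub K2 / planned E2).
-/
import Summits.QuantumFields.YangMills.Theorems.SoftLoopLongLagColdBoxSoftLoopLagFloorStubGaussCore
import Summits.QuantumFields.YangMills.Theorems.SourcedPressureJensenSourcedPressureIncrementCurvatureDecay
import Literature.Probability.LatticeModels.LatticeGreenHeatKernel

/-!
# Reflection symmetry of the free lattice-Maxwell mutual inductances and the vanishing of ODD-weighted lag sums over the centred cube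
# (route `SoftLoopLongLag`, G-free bookkeeping for the background term of S2b/E1b and the mean smoothness of K2/E2)

WHAT.  Let `σᵢ` be the reflection `z ↦ (z with zᵢ ↦ −zᵢ)` of `ℤ⁴`.
* `latticeGreen_reflect` — `latticeGreen (σᵢ z) = latticeGreen z` (heat-kernel product representation, each factor even);
* `mutualInductance_reflect` — `mutualInductance (σᵢ x) (σᵢ y) R = mutualInductance x y R` for every coordinate `i` (for the in-plane directions
  `i = 1, 2` the two surface parametrisations are swapped);
* `sum_sum_mul_mutualInductance_lag_eq_zero_of_odd` — for a SPATIAL direction `i ∈ {1,2,3}`, a lag `T` and any weight `w` that is ODD under `σᵢ`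
  (`w (σᵢ x) = −w x`):  `Σ_{x, x' ∈ timeZeroCube R} w x · mutualInductance x (x' + T e₀) R = 0`.

WHY (card `Cruxes/ColdBoxSoftLoopLagFloor/Lines/birth.md`, «the background term»): in the linear background term
`β Σ_{ℓ,ℓ'} w_ℓ w'_{ℓ'} M(ℓ, ℓ'+R)` the weights of a smooth background are `w̄ + (gradient)·x + O(curvature)`; the constant part is `≥ 0`
(landed `sum_sum_mul_mul_mutualInductance_lag_nonneg`), and THIS file kills the constant × gradient cross terms (a linear coordinate function is odd
under the corresponding reflection of the centred cube), leaving only second-order terms — which is what makes the registered price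
`C·R¹²·β^κ/n²` (rather than the crude `C·R¹¹·β^κ/n`) attainable.

HONEST LABEL.  Free-field bookkeeping for a RECORD-label rung line (R2xi-G, leaf `WeakCouplingRates.XiPow` = an UPPER bound on the lattice mass gap);
NOT the Clay mass gap; no summit statement is touched.
-/

set_option autoImplicit false

noncomputable section

open Finset Real MeasureTheory
open Literature.Probability.LatticeModels (Site box mem_box latticeGreen srwHeatKernel srwHeatKernel_neg
  latticeGreen_eq_integral_prod_srwHeatKernel)
open Literature.MathematicalPhysics.QuantumLattice (ZdPlaquette)
open Literature.MathematicalPhysics.QuantumFieldTheory (curvatureTwoPoint)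
open Summit.QuantumFields.YangMills.Cruxes.SourcedPressureIncrement.Birth (curvatureTwoPoint_parallel_eq)

namespace Summit.QuantumFields.YangMills.Theorems.SoftLoopLongLag

/-! ### §1. Coordinate reflections of `ℤ⁴` -/

/-- The reflection of the `i`-th coordinate: `σᵢ z = z` with `zᵢ ↦ −zᵢ`. -/
def reflectCoordZ (i : Fin 4) (z : Site 4) : Site 4 := Function.update z i (-z i)

/-- `σᵢ` evaluated at `i`. -/
@[simp] theorem reflectCoordZ_apply_same (i : Fin 4) (z : Site 4) : reflectCoordZ i z i = -z i := by
  simp [reflectCoordZ]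

/-- `σᵢ` evaluated off `i`. -/
@[simp] theorem reflectCoordZ_apply_ne {i j : Fin 4} (h : j ≠ i) (z : Site 4) : reflectCoordZ i z j = z j := by
  simp [reflectCoordZ, h]

/-- `σᵢ` is an involution. -/
@[simp] theorem reflectCoordZ_reflectCoordZ (i : Fin 4) (z : Site 4) : reflectCoordZ i (reflectCoordZ i z) = z := by
  ext j
  by_cases h : j = i
  · subst h; simp
  · simp [h]

/-- `σᵢ` is additive. -/
theorem reflectCoordZ_add (i : Fin 4) (z w : Site 4) : reflectCoordZ i (z + w) = reflectCoordZ i z + reflectCoordZ i w := by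
  ext j
  by_cases h : j = i
  · subst h; simp [add_comm]
  · simp [h]

/-- `σᵢ` is compatible with subtraction. -/
theorem reflectCoordZ_sub (i : Fin 4) (z w : Site 4) : reflectCoordZ i (z - w) = reflectCoordZ i z - reflectCoordZ i w := by
  ext j
  by_cases h : j = i
  · subst h; simp; ring
  · simp [h]

/-- `σᵢ` fixes the unit vectors `eⱼ`, `j ≠ i`. -/
theorem reflectCoordZ_single_ne {i j : Fin 4} (h : j ≠ i) (c : ℤ) : reflectCoordZ i (Pi.single j c) = Pi.single j c := by
  ext k
  by_cases hk : k = i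
  · subst hk; simp [Pi.single_eq_of_ne (Ne.symm h) ]
  · simp [hk]

/-- `σᵢ` negates the unit vector `eᵢ`. -/
theorem reflectCoordZ_single_same (i : Fin 4) (c : ℤ) : reflectCoordZ i (Pi.single i c) = -Pi.single i c := by
  ext k
  by_cases hk : k = i
  · subst hk; simp
  · simp [hk]

/-! ### §2. The Green function and the parallel-plaquette kernel are reflection invariant -/

/-- `latticeGreen (σᵢ z) = latticeGreen z` (`d = 4`): the heat-kernel factors are even. -/
theorem latticeGreen_reflect (i : Fin 4) (z : Site 4) : latticeGreen (reflectCoordZ i z) = latticeGreen z := by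
  obtain ⟨-, h1⟩ := latticeGreen_eq_integral_prod_srwHeatKernel (by norm_num : 3 ≤ 4) (reflectCoordZ i z)
  obtain ⟨-, h2⟩ := latticeGreen_eq_integral_prod_srwHeatKernel (by norm_num : 3 ≤ 4) z
  rw [h1, h2]
  refine integral_congr_ae (ae_of_all _ fun t => ?_)
  refine Finset.prod_congr rfl fun j _ => ?_
  by_cases h : j = i
  · subst h; rw [reflectCoordZ_apply_same, srwHeatKernel_neg]
  · rw [reflectCoordZ_apply_ne h]

/-- The parallel `(1,2)`-kernel as a function of the difference vector. -/
def lagKerZ (z : Site 4) : ℝ :=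
  -((latticeGreen (z + Pi.single 1 1) + latticeGreen (z - Pi.single 1 1) - 2 * latticeGreen z) +
      (latticeGreen (z + Pi.single 2 1) + latticeGreen (z - Pi.single 2 1) - 2 * latticeGreen z)) / 2

/-- `curvatureTwoPoint (u; 1,2) (v; 1,2) = lagKerZ (u − v)`. -/
theorem curvatureTwoPoint_plane12_eq_lagKerZ (u v : Site 4) :
    curvatureTwoPoint ((u, ⟨((1 : Fin 4), (2 : Fin 4)), by decide⟩) : ZdPlaquette 4) (v, ⟨((1 : Fin 4), (2 : Fin 4)), by decide⟩) =
      lagKerZ (u - v) :=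
  curvatureTwoPoint_parallel_eq u v _

/-- `lagKerZ (σᵢ z) = lagKerZ z` for every coordinate `i` (the symmetric second differences are reflection invariant). -/
theorem lagKerZ_reflect (i : Fin 4) (z : Site 4) : lagKerZ (reflectCoordZ i z) = lagKerZ z := by
  -- for each direction `j`, `{G(σz + eⱼ), G(σz − eⱼ)} = {G(z + eⱼ), G(z − eⱼ)}`
  have key : ∀ j : Fin 4, latticeGreen (reflectCoordZ i z + Pi.single j 1) + latticeGreen (reflectCoordZ i z - Pi.single j 1) =
      latticeGreen (z + Pi.single j 1) + latticeGreen (z - Pi.single j 1) := by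
    intro j
    by_cases h : j = i
    · subst h
      have e1 : reflectCoordZ j z + Pi.single j 1 = reflectCoordZ j (z - Pi.single j 1) := by
        rw [reflectCoordZ_sub, reflectCoordZ_single_same, sub_neg_eq_add]
      have e2 : reflectCoordZ j z - Pi.single j 1 = reflectCoordZ j (z + Pi.single j 1) := by
        rw [reflectCoordZ_add, reflectCoordZ_single_same, ← sub_eq_add_neg]
      rw [e1, e2, latticeGreen_reflect, latticeGreen_reflect, add_comm]
    · have e1 : reflectCoordZ i z + Pi.single j 1 = reflectCoordZ i (z + Pi.single j 1) := by
        rw [reflectCoordZ_add, reflectCoordZ_single_ne h]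
      have e2 : reflectCoordZ i z - Pi.single j 1 = reflectCoordZ i (z - Pi.single j 1) := by
        rw [reflectCoordZ_sub, reflectCoordZ_single_ne h]
      rw [e1, e2, latticeGreen_reflect, latticeGreen_reflect]
  simp only [lagKerZ, latticeGreen_reflect]
  rw [key 1, key 2]

/-! ### §3. Reflection invariance of the mutual inductance -/

/-- The mutual inductance through the difference kernel: `M(x, y; R) = Σ_{a,b,a',b' < R} lagKerZ (x − y + (a − a') e₁ + (b − b') e₂)`. -/
theorem mutualInductance_eq_sum_lagKerZ (x y : Site 4) (R : ℕ) :
    mutualInductance x y R = ∑ a ∈ range R, ∑ b ∈ range R, ∑ a' ∈ range R, ∑ b' ∈ range R,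
      lagKerZ (x - y + Pi.single 1 ((a : ℤ) - a') + Pi.single 2 ((b : ℤ) - b')) := by
  rw [mutualInductance, sum_rectSurface_eq]
  simp_rw [sum_rectSurface_eq y]
  refine sum_congr rfl fun a _ => sum_congr rfl fun b _ => sum_congr rfl fun a' _ => sum_congr rfl fun b' _ => ?_
  rw [curvatureTwoPoint_plane12_eq_lagKerZ]
  congr 1
  rw [Pi.single_sub, Pi.single_sub]
  abel

/-- Reordering a four-fold sum: move the third binder next to the first. -/
theorem sum4_comm23 (R : ℕ) (F : ℕ → ℕ → ℕ → ℕ → ℝ) :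
    ∑ a ∈ range R, ∑ b ∈ range R, ∑ a' ∈ range R, ∑ b' ∈ range R, F a b a' b' =
      ∑ a ∈ range R, ∑ a' ∈ range R, ∑ b ∈ range R, ∑ b' ∈ range R, F a b a' b' :=
  sum_congr rfl fun _ _ => sum_comm

/-- Reordering a four-fold sum: swap the last two binders. -/
theorem sum4_comm34 (R : ℕ) (F : ℕ → ℕ → ℕ → ℕ → ℝ) :
    ∑ a ∈ range R, ∑ b ∈ range R, ∑ a' ∈ range R, ∑ b' ∈ range R, F a b a' b' =
      ∑ a ∈ range R, ∑ b ∈ range R, ∑ b' ∈ range R, ∑ a' ∈ range R, F a b a' b' :=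
  sum_congr rfl fun _ _ => sum_congr rfl fun _ _ => sum_comm

/-- Reflection in a direction transverse to the loop plane (`i = 0` or `i = 3`): `M(σᵢ x, σᵢ y) = M(x, y)`. -/
theorem mutualInductance_reflect_of_ne {i : Fin 4} (h1 : (1 : Fin 4) ≠ i) (h2 : (2 : Fin 4) ≠ i) (x y : Site 4) (R : ℕ) :
    mutualInductance (reflectCoordZ i x) (reflectCoordZ i y) R = mutualInductance x y R := by
  rw [mutualInductance_eq_sum_lagKerZ, mutualInductance_eq_sum_lagKerZ]
  refine sum_congr rfl fun a _ => sum_congr rfl fun b _ => sum_congr rfl fun a' _ => sum_congr rfl fun b' _ => ?_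
  have e : reflectCoordZ i x - reflectCoordZ i y + Pi.single 1 ((a : ℤ) - a') + Pi.single 2 ((b : ℤ) - b') =
      reflectCoordZ i (x - y + Pi.single 1 ((a : ℤ) - a') + Pi.single 2 ((b : ℤ) - b')) := by
    rw [reflectCoordZ_add, reflectCoordZ_add, reflectCoordZ_sub, reflectCoordZ_single_ne h1, reflectCoordZ_single_ne h2]
  rw [e, lagKerZ_reflect]

/-- Reflection in the in-plane direction `1`: `M(σ₁ x, σ₁ y) = M(x, y)` (swap the two `e₁`-parametrisations). -/
theorem mutualInductance_reflect_one (x y : Site 4) (R : ℕ) :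
    mutualInductance (reflectCoordZ 1 x) (reflectCoordZ 1 y) R = mutualInductance x y R := by
  rw [mutualInductance_eq_sum_lagKerZ, mutualInductance_eq_sum_lagKerZ, sum4_comm23]
  conv_rhs => rw [sum4_comm23]
  rw [sum_comm]
  refine sum_congr rfl fun u _ => sum_congr rfl fun v _ => sum_congr rfl fun b _ => sum_congr rfl fun b' _ => ?_
  have h2 : (2 : Fin 4) ≠ 1 := by decide
  have e : reflectCoordZ 1 x - reflectCoordZ 1 y + Pi.single 1 ((v : ℤ) - u) + Pi.single 2 ((b : ℤ) - b') =
      reflectCoordZ 1 (x - y + Pi.single 1 ((u : ℤ) - v) + Pi.single 2 ((b : ℤ) - b')) := by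
    rw [reflectCoordZ_add, reflectCoordZ_add, reflectCoordZ_sub, reflectCoordZ_single_same, reflectCoordZ_single_ne h2,
      ← Pi.single_neg, neg_sub]
  rw [e, lagKerZ_reflect]

/-- Reflection in the in-plane direction `2`: `M(σ₂ x, σ₂ y) = M(x, y)` (swap the two `e₂`-parametrisations). -/
theorem mutualInductance_reflect_two (x y : Site 4) (R : ℕ) :
    mutualInductance (reflectCoordZ 2 x) (reflectCoordZ 2 y) R = mutualInductance x y R := by
  rw [mutualInductance_eq_sum_lagKerZ, mutualInductance_eq_sum_lagKerZ, sum4_comm34]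
  conv_rhs => rw [sum4_comm34]
  refine sum_congr rfl fun a _ => ?_
  rw [sum_comm]
  refine sum_congr rfl fun u _ => sum_congr rfl fun v _ => sum_congr rfl fun a' _ => ?_
  have h1 : (1 : Fin 4) ≠ 2 := by decide
  have e : reflectCoordZ 2 x - reflectCoordZ 2 y + Pi.single 1 ((a : ℤ) - a') + Pi.single 2 ((v : ℤ) - u) =
      reflectCoordZ 2 (x - y + Pi.single 1 ((a : ℤ) - a') + Pi.single 2 ((u : ℤ) - v)) := by
    rw [reflectCoordZ_add, reflectCoordZ_add, reflectCoordZ_sub, reflectCoordZ_single_same, reflectCoordZ_single_ne h1,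
      ← Pi.single_neg, neg_sub]
  rw [e, lagKerZ_reflect]

/-- **Reflection invariance of the mutual inductance** in every coordinate direction. -/
theorem mutualInductance_reflect (i : Fin 4) (x y : Site 4) (R : ℕ) :
    mutualInductance (reflectCoordZ i x) (reflectCoordZ i y) R = mutualInductance x y R := by
  fin_cases i
  · exact mutualInductance_reflect_of_ne (by decide) (by decide) x y R
  · exact mutualInductance_reflect_one x y R
  · exact mutualInductance_reflect_two x y R
  · exact mutualInductance_reflect_of_ne (by decide) (by decide) x y R

/-! ### §4. Odd weights integrate to zero against the lag kernel over the centred cube -/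

/-- The time-zero cube is invariant under a spatial reflection. -/
theorem reflectCoordZ_mem_timeZeroCube {i : Fin 4} (hi : i ≠ 0) {R : ℕ} {x : Site 4} (hx : x ∈ timeZeroCube R) :
    reflectCoordZ i x ∈ timeZeroCube R := by
  rw [timeZeroCube, mem_filter, mem_box] at hx ⊢
  refine ⟨fun j => ?_, ?_⟩
  · by_cases h : j = i
    · subst h; rw [reflectCoordZ_apply_same]; have := hx.1 j; omega
    · rw [reflectCoordZ_apply_ne h]; exact hx.1 j
  · rw [reflectCoordZ_apply_ne hi.symm]; exact hx.2

/-- Re-indexing a sum over the time-zero cube by a spatial reflection. -/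
theorem sum_timeZeroCube_reflect {i : Fin 4} (hi : i ≠ 0) (R : ℕ) (g : Site 4 → ℝ) :
    ∑ x ∈ timeZeroCube R, g (reflectCoordZ i x) = ∑ x ∈ timeZeroCube R, g x :=
  sum_nbij' (reflectCoordZ i) (reflectCoordZ i) (fun _ hx => reflectCoordZ_mem_timeZeroCube hi hx)
    (fun _ hx => reflectCoordZ_mem_timeZeroCube hi hx) (fun x _ => reflectCoordZ_reflectCoordZ i x)
    (fun x _ => reflectCoordZ_reflectCoordZ i x) (fun _ _ => rfl)

/-- The lag row sums `m(x) = Σ_{x' ∈ cube} M(x, x' + T e₀; R)` are even under every spatial reflection. -/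
theorem lagRowSum_reflect {i : Fin 4} (hi : i ≠ 0) (R T : ℕ) (x : Site 4) :
    ∑ x' ∈ timeZeroCube R, mutualInductance (reflectCoordZ i x) (x' + Pi.single 0 (T : ℤ)) R =
      ∑ x' ∈ timeZeroCube R, mutualInductance x (x' + Pi.single 0 (T : ℤ)) R := by
  have h := sum_timeZeroCube_reflect hi R (fun x' => mutualInductance (reflectCoordZ i x) (x' + Pi.single 0 (T : ℤ)) R)
  rw [← h]
  refine sum_congr rfl fun x' _ => ?_
  have e : reflectCoordZ i x' + Pi.single 0 (T : ℤ) = reflectCoordZ i (x' + Pi.single 0 (T : ℤ)) := by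
    rw [reflectCoordZ_add, reflectCoordZ_single_ne hi.symm]
  rw [e, mutualInductance_reflect]

/-- **Odd weights integrate to zero against the lag kernel.**  For a spatial direction `i ≠ 0`, a lag `T` and a weight `w` that is odd under
`σᵢ`, `Σ_{x, x' ∈ timeZeroCube R} w x · mutualInductance x (x' + T e₀) R = 0`. -/
theorem sum_sum_mul_mutualInductance_lag_eq_zero_of_odd {i : Fin 4} (hi : i ≠ 0) (R T : ℕ) (w : Site 4 → ℝ)
    (hw : ∀ x, w (reflectCoordZ i x) = -w x) :
    ∑ x ∈ timeZeroCube R, ∑ x' ∈ timeZeroCube R, w x * mutualInductance x (x' + Pi.single 0 (T : ℤ)) R = 0 := by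
  set m : Site 4 → ℝ := fun x => ∑ x' ∈ timeZeroCube R, mutualInductance x (x' + Pi.single 0 (T : ℤ)) R with hm
  have hm_even : ∀ x, m (reflectCoordZ i x) = m x := fun x => by
    simp only [hm]; exact lagRowSum_reflect hi R T x
  have hS : ∑ x ∈ timeZeroCube R, ∑ x' ∈ timeZeroCube R, w x * mutualInductance x (x' + Pi.single 0 (T : ℤ)) R =
      ∑ x ∈ timeZeroCube R, w x * m x := sum_congr rfl fun x _ => by rw [hm, mul_sum]
  have hrefl := sum_timeZeroCube_reflect hi R (fun x => w x * m x)
  have hneg : ∑ x ∈ timeZeroCube R, w x * m x = -∑ x ∈ timeZeroCube R, w x * m x := by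
    calc ∑ x ∈ timeZeroCube R, w x * m x = ∑ x ∈ timeZeroCube R, w (reflectCoordZ i x) * m (reflectCoordZ i x) := hrefl.symm
      _ = ∑ x ∈ timeZeroCube R, -(w x * m x) := sum_congr rfl fun x _ => by rw [hw, hm_even]; ring
      _ = -∑ x ∈ timeZeroCube R, w x * m x := sum_neg_distrib _
  rw [hS]
  linarith

end Summit.QuantumFields.YangMills.Theorems.SoftLoopLongLag

end
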